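import Literature.Barriers.CriticalPhenomena.PlaquetteWalkHoleRootHoleColumnLoop
import HarnessLib

/-!
# Barrier catalogue (SAWScalingLimit): in the HOLE COLUMN, after the loop under the hole the straight level-`7` member climbs back to the row of `r` — through the KISS
at the first turning plaquette or STRAIGHT across the root row («HOLE COLUMN: THE ROOT-ROW PASSAGE, PINNED»)

`Z → ∞` limit model of the printed Yang–Baxter weights [GlazmanManolescu2019, §1, eq. (1)]; the «RECTANGLE COEFFICIENT» line (b-engine-1 g29), the frame of the
HOLE-COLUMN programme (FINDING-YB-HOLE-COLUMN-FOUR-PHASE; DESIGN-next b-engine-1 g28 §7). In the setting of `ΩG.loop_of_cost_seven_straight_holeColumn_above` (the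
excursion of the wound cost-`7` member at a hole-column rhombus above the hole is pinned from the first hit through the loop under the hole into the root-row plaquette
`q = (k₀, w.2)`, entered from `S` at the index `i₀`, with `k₀ ≥ x₁ := w.1 + k₁`, `p₁ = (x₁, w.2)` the first turning plaquette):

* ★★★ `ΩG.rootRowClimb_of_cost_seven_straight_holeColumn_above`: EITHER (I) `k₀ = x₁`: `q = p₁` is a KISS plaquette — the prefix turns `N` there (`sOut k₁ = N`) and the
  loop leaves it through `E` —, the walk runs east along the root row to the root-row turn `τ = (τ1, w.2)`, `τ1 > x₁`, and climbs the column `τ1`; OR (II) `k₀ > x₁`: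
  then `τ = p₁` (`τ1 = x₁`), `p₁` uses neither `S` nor `E`, `q` does not use `W`, and the walk crosses `q` STRAIGHT upwards and climbs the column `k₀`. In both cases the
  climb column `c₁` (`= τ1`, resp. `= k₀`) is followed straight from the root row to the plaquette `(c₁, r.2)` of the row of `r`, entered from `S` at the index
  `i₁ = i₀ + (c₁ − k₀) + (r.2 − w.2) < n`; every arc from `i₀` to `i₁` is pinned. (The residual case (III) of `ΩG.rootRowPassage_of_cost_seven_straight_holeColumn_above`
  — a turn at `q` east of `p₁` — is thereby excluded: such a `q` would be an isolated root-row turn other than `τ = p₁`.)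

[GlazmanManolescu2019 §1 Fig. 1, eq. (1), Lemma 2.1, Remark 2.2; Glazman2015WeightedSAW Lemma 3.1 (proof, pp. 6–7); CourantRobbins1958 Ch. V App. §2 (the even–odd rule)]
-/

noncomputable section

namespace Literature.Probability.RandomPlanarGeometry.SAW.YangBaxter

open Real
open Literature.Barriers.CriticalPhenomena.PlaquetteWalk

open private fc_fh fh_add_Mv three_le_Mv from Literature.Probability.RandomPlanarGeometry.YangBaxterSAWGeneralDomain
open private fc_sOut_pred_of_sIn_S fc_sOut_pred_of_sIn_N from Literature.Barriers.CriticalPhenomena.PlaquetteWalkStraightRuns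
open private sIn_succ_eq_S sIn_succ_eq_N from Literature.Barriers.CriticalPhenomena.PlaquetteWalkKissChains

namespace ΩG

variable {D : Set Face} {w r : Face} {ω : ΩG D (w.side .W) r}

/-- ★★★ **HOLE COLUMN: THE ROOT-ROW PASSAGE, PINNED.** Let `ω` be a wound class-`B2a` walk of limit cost `7` from the hole root `w.side W` (hole `(w.1 − 1, w.2)` absent)
with a slanted end and a STRAIGHT first arc at a rhombus `r` of the hole column (`r.1 = w.1 − 1`) strictly above the hole, some arc of `ω` lying strictly above the row
of `r`. Then, with the data of `loop_of_cost_seven_straight_holeColumn_above` (the loop pinned into `q = (k₀, w.2)` entered from `S` at `i₀`; `x₁ = w.1 + k₁` the column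
of the first turning plaquette `p₁`) and a climb column `c₁`: EITHER `k₀ = x₁ < τ1 = c₁`, `sOut k₁ = N`, the loop leaves `p₁` through `E`, the plaquettes
`(x₁ + m, w.2)`, `1 ≤ m ≤ τ1 − x₁`, follow entered from `W`, and `τ` is left through `N`; OR `x₁ < k₀ = c₁`, `τ1 = x₁`, `p₁` uses neither `S` nor `E`, `q` does not use
`W` and is left through `N`. Then the plaquettes `(c₁, w.2 + m)`, `1 ≤ m ≤ r.2 − w.2`, follow entered from `S`, the last being `(c₁, r.2)` at the index
`i₀ + (c₁ − k₀) + (r.2 − w.2) < n`. [cite: GlazmanManolescu2019, §1, Fig. 1 and eq. (1); Lemma 2.1; Remark 2.2] [cite: Glazman2015WeightedSAW, Lemma 3.1 (proof,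
pp. 6–7)] [cite: CourantRobbins1958, Ch. V Appendix §2 (the even–odd rule)] -/
theorem rootRowClimb_of_cost_seven_straight_holeColumn_above (hh : holeFaceW w ∉ D) (hr : RootedFace D (w.side .W) r) (h : ω.IsB2a)
    (hA : ω.AJ hr h (toC (midPt (w.side .W))) ≠ 0) (hc : cost (slotOfSide ω.1) ω.2.mids = 7) (hz : ω.1 = .N ∨ ω.1 = .S)
    (hstr8 : arcKind (ω.2.sIn ω.2.firstHitG) (ω.2.sOut ω.2.firstHitG) = .straight) (hcol : r.1 = w.1 - 1) (habove : w.2 < r.2)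
    (hup : ∃ j < ω.2.arcs.length, r.2 < (ω.2.fc j).2) :
    ∃ (c₁ : ℤ), ∃ (Y Y' τ1 k₀ : ℤ) (MW ME k₁ : ℕ) (t₂ : Face),
      (∀ j < ω.2.arcs.length, (ω.2.fc j).2 ≤ Y) ∧ (∀ j < ω.2.arcs.length, Y' ≤ (ω.2.fc j).2) ∧ r.2 < Y ∧ Y' < w.2 ∧
      t₂.2 = Y ∧ t₂.1 ≠ r.1 ∧ w.1 ≤ τ1 ∧ 1 ≤ MW ∧ 1 ≤ ME ∧
      (∀ m : ℕ, 1 ≤ m → m ≤ MW → ω.2.UsesSide (r.1 - m, r.2) .E) ∧ (∀ m : ℕ, m < MW → ω.2.UsesSide (r.1 - m, r.2) .W) ∧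
        ¬ω.2.UsesSide (r.1 - MW, r.2) .W ∧
      (∀ m : ℕ, 1 ≤ m → m ≤ ME → ω.2.UsesSide (r.1 + m, r.2) .W) ∧ (∀ m : ℕ, m < ME → ω.2.UsesSide (r.1 + m, r.2) .E) ∧
        ¬ω.2.UsesSide (r.1 + ME, r.2) .E ∧
      (∀ f ∈ ({((r.1 : ℤ), Y), t₂, ((r.1 : ℤ) - MW, Y'), (k₀, Y'), ((τ1 : ℤ), w.2), ((r.1 : ℤ) - MW, r.2), ((r.1 : ℤ) + ME, r.2)} : Finset Face),
        f ∈ facesL ω.2.mids ∧ (kindsL ω.2.mids f = [.corner] ∨ kindsL ω.2.mids f = [.coCorner])) ∧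
      (∀ f : Face, f ∈ facesL ω.2.mids → (kindsL ω.2.mids f = [.corner] ∨ kindsL ω.2.mids f = [.coCorner]) →
        f ∈ ({((r.1 : ℤ), Y), t₂, ((r.1 : ℤ) - MW, Y'), (k₀, Y'), ((τ1 : ℤ), w.2), ((r.1 : ℤ) - MW, r.2), ((r.1 : ℤ) + ME, r.2)} : Finset Face)) ∧
      ω.1 = .N ∧ ω.2.fc (ω.2.arcs.length - 1) = (r.1, r.2 + 1) ∧ ω.2.sOut (ω.2.arcs.length - 1) = .S ∧
      (∀ m : ℕ, (m : ℤ) ≤ Y - r.2 - 1 → ω.2.fc (ω.2.arcs.length - 1 - m) = (r.1, r.2 + 1 + m)) ∧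
      (∀ m : ℕ, (m : ℤ) < Y - r.2 - 1 → ω.2.sIn (ω.2.arcs.length - 1 - m) = .N) ∧
      ω.2.UsesSide (r.1 - MW, r.2) .S ∧ ¬ω.2.UsesSide (r.1 - MW, r.2) .N ∧
      (∀ m : ℕ, 1 ≤ m → (m : ℤ) ≤ r.2 - Y' → ω.2.UsesSide (r.1 - MW, r.2 - m) .N) ∧
      (∀ m : ℕ, (m : ℤ) < r.2 - Y' → ω.2.UsesSide (r.1 - MW, r.2 - m) .S) ∧ ¬ω.2.UsesSide (r.1 - MW, Y') .S ∧
      -- new in this car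
      k₁ ≤ ω.2.firstHitG ∧ (∀ j < k₁, arcKind (ω.2.sIn j) (ω.2.sOut j) = .straight) ∧ arcKind (ω.2.sIn k₁) (ω.2.sOut k₁) ≠ .straight ∧
      ω.2.fc k₁ = (w.1 + k₁, w.2) ∧ ω.2.sIn k₁ = .W ∧ w.1 + k₁ ≤ k₀ ∧
      (∀ x : ℤ, ¬ω.2.UsesSide (x, Y') .S) ∧ ¬ω.2.UsesSide (r.1 - MW, Y') .W ∧ ¬ω.2.UsesSide (k₀, Y') .E ∧ ¬ω.2.UsesSide (k₀, Y') .S ∧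
      ω.2.sIn ω.2.firstHitG = .E ∧ ω.2.sOut ω.2.firstHitG = .W ∧
      (∀ m : ℕ, m ≤ MW → ω.2.fc (ω.2.firstHitG + m) = (r.1 - m, r.2) ∧ ω.2.sIn (ω.2.firstHitG + m) = .E) ∧
      (∀ m : ℕ, 1 ≤ m → (m : ℤ) ≤ r.2 - Y' → ω.2.fc (ω.2.firstHitG + MW + m) = (r.1 - MW, r.2 - m) ∧ ω.2.sIn (ω.2.firstHitG + MW + m) = .N) ∧
      (∀ m : ℕ, 1 ≤ m → (m : ℤ) ≤ k₀ - (r.1 - MW) →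
        ω.2.fc (ω.2.firstHitG + MW + (r.2 - Y').toNat + m) = (r.1 - MW + m, Y') ∧ ω.2.sIn (ω.2.firstHitG + MW + (r.2 - Y').toNat + m) = .W) ∧
      (∀ m : ℕ, 1 ≤ m → (m : ℤ) ≤ w.2 - Y' →
        ω.2.fc (ω.2.firstHitG + MW + (r.2 - Y').toNat + (k₀ - (r.1 - MW)).toNat + m) = (k₀, Y' + m) ∧
          ω.2.sIn (ω.2.firstHitG + MW + (r.2 - Y').toNat + (k₀ - (r.1 - MW)).toNat + m) = .S) ∧
      ω.2.firstHitG + MW + (r.2 - Y').toNat + (k₀ - (r.1 - MW)).toNat + (w.2 - Y').toNat < ω.2.arcs.length ∧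
      -- new in this car: the root-row passage and the climb to the row of `r`
      ((k₀ = w.1 + k₁ ∧ w.1 + k₁ < τ1 ∧ c₁ = τ1 ∧ ω.2.sOut k₁ = .N ∧
          ω.2.sOut (ω.2.firstHitG + MW + (r.2 - Y').toNat + (k₀ - (r.1 - MW)).toNat + (w.2 - Y').toNat) = .E ∧
          (∀ m : ℕ, 1 ≤ m → (m : ℤ) ≤ τ1 - (w.1 + k₁) →
            ω.2.fc (ω.2.firstHitG + MW + (r.2 - Y').toNat + (k₀ - (r.1 - MW)).toNat + (w.2 - Y').toNat + m) = (w.1 + k₁ + m, w.2) ∧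
            ω.2.sIn (ω.2.firstHitG + MW + (r.2 - Y').toNat + (k₀ - (r.1 - MW)).toNat + (w.2 - Y').toNat + m) = .W) ∧
          ω.2.sOut (ω.2.firstHitG + MW + (r.2 - Y').toNat + (k₀ - (r.1 - MW)).toNat + (w.2 - Y').toNat + (τ1 - (w.1 + k₁)).toNat) = .N) ∨
        (w.1 + k₁ < k₀ ∧ τ1 = w.1 + k₁ ∧ c₁ = k₀ ∧ ¬ω.2.UsesSide (w.1 + k₁, w.2) .S ∧ ¬ω.2.UsesSide (w.1 + k₁, w.2) .E ∧ ¬ω.2.UsesSide (k₀, w.2) .W ∧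
          ω.2.sOut (ω.2.firstHitG + MW + (r.2 - Y').toNat + (k₀ - (r.1 - MW)).toNat + (w.2 - Y').toNat) = .N)) ∧
      (∀ m : ℕ, 1 ≤ m → (m : ℤ) ≤ r.2 - w.2 →
        ω.2.fc (ω.2.firstHitG + MW + (r.2 - Y').toNat + (k₀ - (r.1 - MW)).toNat + (w.2 - Y').toNat + (c₁ - k₀).toNat + m) = (c₁, w.2 + m) ∧
          ω.2.sIn (ω.2.firstHitG + MW + (r.2 - Y').toNat + (k₀ - (r.1 - MW)).toNat + (w.2 - Y').toNat + (c₁ - k₀).toNat + m) = .S) ∧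
      ω.2.firstHitG + MW + (r.2 - Y').toNat + (k₀ - (r.1 - MW)).toNat + (w.2 - Y').toNat + (c₁ - k₀).toNat + (r.2 - w.2).toNat < ω.2.arcs.length := by
  classical
  set n := ω.2.arcs.length with hn
  ---------------------------------------------------------------- basics
  have hF := ω.fh_lt h
  have hlen : 0 < n := by omega
  have h0w : ω.2.fc 0 = w := fc_zero_eq_root w hh ω.2 hlen
  have h0W : ω.2.sIn 0 = .W := YBWalk.sIn_zero_eq_W hh ω.2 hlen
  have h0E : ω.2.sIn 0 ≠ .E := by rw [h0W]; decide
  have h0N : ω.2.sIn 0 ≠ .N := by rw [h0W]; decide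
  have h0S : ω.2.sIn 0 ≠ .S := by rw [h0W]; decide
  have hfcF := (fc_fh ω hr h).1
  have hsvr : ∀ l < n, ω.2.fc l = ω.2.fc ω.2.firstHitG → l = ω.2.firstHitG := fun l hl e => eq_firstHitG_of_fc_eq hr h hl e
  have hn1 : n - 1 < n := by omega
  have hwr : r.1 < w.1 := by omega
  ---------------------------------------------------------------- the loop (car 42) with the seven turns
  obtain ⟨Y, Y', τ1, k₀, MW, ME, k₁, t₂, hY, hY', hr₃, hY'w, ht₂row, ht₂col, hτ1w, hMW1, hME1, hEW, hWW, hnotW, hWE, hEE, hnotE,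
    hseven, hall, hN1, hL, hLS, hdesc, hdescIn, heWS, heWnN, hlegN, hlegS, hbWnS, hk₁F, hstr, hk₁ns, hfk, hWk, hk₀w, hbotS, hbWnW, hbEnE, hbEnS,
    hinF, houtF, hrunR, hrunL, hrunB, hrunE, hi₀n⟩ :=
    loop_of_cost_seven_straight_holeColumn_above hh hr h hA hc hz hstr8 hcol habove hup
  let P : Face → Prop := fun f => f ∈ facesL ω.2.mids ∧ (kindsL ω.2.mids f = [.corner] ∨ kindsL ω.2.mids f = [.coCorner])
  have hPiso : ∀ k < n, (∀ l < n, ω.2.fc l = ω.2.fc k → l = k) → arcKind (ω.2.sIn k) (ω.2.sOut k) ≠ .straight → P (ω.2.fc k) :=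
    fun k hk hsv hkind => isolated_turn hk hsv hkind
  have hmem7 : ∀ f : Face, P f → f = ((r.1 : ℤ), Y) ∨ f = t₂ ∨ f = ((r.1 : ℤ) - MW, Y') ∨ f = (k₀, Y') ∨ f = ((τ1 : ℤ), w.2) ∨
      f = ((r.1 : ℤ) - MW, r.2) ∨ f = ((r.1 : ℤ) + ME, r.2) := by
    intro f hPf
    have := hall f hPf.1 hPf.2
    simpa only [Finset.mem_insert, Finset.mem_singleton] using this
  have hP7 : ∀ f : Face, (f = ((r.1 : ℤ), Y) ∨ f = t₂ ∨ f = ((r.1 : ℤ) - MW, Y') ∨ f = (k₀, Y') ∨ f = ((τ1 : ℤ), w.2) ∨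
      f = ((r.1 : ℤ) - MW, r.2) ∨ f = ((r.1 : ℤ) + ME, r.2)) → P f := by
    intro f hf
    apply hseven
    simpa only [Finset.mem_insert, Finset.mem_singleton] using hf
  have hProw : ∀ f : Face, P f → f.2 = Y ∨ f.2 = Y' ∨ f.2 = w.2 ∨ f.2 = r.2 := by
    intro f hPf
    rcases hmem7 f hPf with rfl | rfl | rfl | rfl | rfl | rfl | rfl
    · exact Or.inl rfl
    · exact Or.inl ht₂row
    · exact Or.inr (Or.inl rfl)
    · exact Or.inr (Or.inl rfl)
    · exact Or.inr (Or.inr (Or.inl rfl))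
    · exact Or.inr (Or.inr (Or.inr rfl))
    · exact Or.inr (Or.inr (Or.inr rfl))
  have hbots : ∀ f : Face, P f → f.2 = Y' → f = ((r.1 : ℤ) - MW, Y') ∨ f = (k₀, Y') := by
    intro f hPf hfY
    rcases hmem7 f hPf with e | e | e | e | e | e | e
    · exfalso; rw [e] at hfY; simp only at hfY; omega
    · exfalso; rw [e, ht₂row] at hfY; omega
    · exact Or.inl e
    · exact Or.inr e
    · exfalso; rw [e] at hfY; simp only at hfY; omega
    · exfalso; rw [e] at hfY; simp only at hfY; omega
    · exfalso; rw [e] at hfY; simp only at hfY; omega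
  obtain ⟨X', -, hX', -⟩ := exists_right_entry_turn hh hr h
  obtain ⟨X, hXw, hX, -⟩ := exists_left_entry_turn hh hr h hA
  ---------------------------------------------------------------- rows: a plaquette using `E` or `W` lies on one of the four turn rows
  have hrowE : ∀ c : Face, ω.2.UsesSide c .E → c.2 = Y ∨ c.2 = Y' ∨ c.2 = w.2 ∨ c.2 = r.2 := by
    intro c hcE
    obtain ⟨M, hWall, -, hend⟩ := ω.2.chain_E hX' hcE
    rcases hend with ⟨hM1, hnot⟩ | ⟨-, hs0⟩ | ⟨-, hsZ⟩
    · obtain ⟨i', hi', hfc', hsv', -, -, -, hk'⟩ := ω.2.isolated_of_usesSide_not_opp (hWall M hM1 le_rfl) hnot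
      have hP' : P (c.1 + M, c.2) := by rw [← hfc']; exact hPiso i' hi' hsv' hk'
      have := hProw _ hP'; simp only at this; exact this
    · exact absurd hs0 h0E
    · rw [hLS] at hsZ; exact absurd hsZ (by decide)
  have hrowW : ∀ c : Face, ω.2.UsesSide c .W → c.2 = Y ∨ c.2 = Y' ∨ c.2 = w.2 ∨ c.2 = r.2 := by
    intro c hcW
    obtain ⟨M, hEall, -, hend⟩ := ω.2.chain_W hX hcW
    rcases hend with ⟨hM1, hnot⟩ | ⟨hA0, -⟩ | ⟨-, hsZ⟩
    · obtain ⟨i', hi', hfc', hsv', -, -, -, hk'⟩ := ω.2.isolated_of_usesSide_not_opp (hEall M hM1 le_rfl) hnot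
      have hP' : P (c.1 - M, c.2) := by rw [← hfc']; exact hPiso i' hi' hsv' hk'
      have := hProw _ hP'; simp only at this; exact this
    · rw [h0w] at hA0; have := congrArg Prod.snd hA0; simp only at this; exact Or.inr (Or.inr (Or.inl this))
    · rw [hLS] at hsZ; exact absurd hsZ (by decide)
  have hvert : ∀ i < n, (ω.2.fc i).2 ≠ Y → (ω.2.fc i).2 ≠ Y' → (ω.2.fc i).2 ≠ w.2 → (ω.2.fc i).2 ≠ r.2 →
      arcKind (ω.2.sIn i) (ω.2.sOut i) = .straight := by
    intro i hi h1 h2 h3 h4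
    have hnot : ¬(ω.2.UsesSide (ω.2.fc i) .E ∨ ω.2.UsesSide (ω.2.fc i) .W) := by
      rintro (hu | hu)
      · rcases hrowE _ hu with e | e | e | e
        · exact h1 e
        · exact h2 e
        · exact h3 e
        · exact h4 e
      · rcases hrowW _ hu with e | e | e | e
        · exact h1 e
        · exact h2 e
        · exact h3 e
        · exact h4 e
    have hiE : ω.2.sIn i ≠ .E := fun e => hnot (Or.inl ⟨i, hi, rfl, Or.inl e⟩)
    have hoE : ω.2.sOut i ≠ .E := fun e => hnot (Or.inl ⟨i, hi, rfl, Or.inr e⟩)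
    have hiW : ω.2.sIn i ≠ .W := fun e => hnot (Or.inr ⟨i, hi, rfl, Or.inl e⟩)
    have hoW : ω.2.sOut i ≠ .W := fun e => hnot (Or.inr ⟨i, hi, rfl, Or.inr e⟩)
    have hne := ω.2.sIn_ne_sOut hi
    revert hiE hoE hiW hoW hne
    cases ω.2.sIn i <;> cases ω.2.sOut i <;> decide
  ---------------------------------------------------------------- abbreviations for the pinned indices
  obtain ⟨dB, hdB⟩ : ∃ dB : ℕ, (dB : ℤ) = w.2 - Y' - 1 := ⟨(w.2 - Y' - 1).toNat, by omega⟩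
  obtain ⟨dR, hdR⟩ : ∃ dR : ℕ, (dR : ℤ) = k₀ - (r.1 - MW) - 1 := ⟨(k₀ - (r.1 - MW) - 1).toNat, by omega⟩
  obtain ⟨dL, hdL⟩ : ∃ dL : ℕ, (dL : ℤ) = r.2 - Y' - 1 := ⟨(r.2 - Y' - 1).toNat, by omega⟩
  obtain ⟨dM, hdM⟩ : ∃ dM : ℕ, (dM : ℤ) = r.2 - w.2 - 1 := ⟨(r.2 - w.2 - 1).toNat, by omega⟩
  have htoNat : ∀ (a : ℤ) (k : ℕ), a = k → a.toNat = k := fun a k e => by subst e; exact Int.toNat_natCast k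
  rw [htoNat (r.2 - Y') (dL + 1) (by push_cast; omega), htoNat (k₀ - (r.1 - MW)) (dR + 1) (by push_cast; omega),
    htoNat (w.2 - Y') (dB + 1) (by push_cast; omega)] at hi₀n
  rw [htoNat (r.2 - Y') (dL + 1) (by push_cast; omega), htoNat (k₀ - (r.1 - MW)) (dR + 1) (by push_cast; omega)] at hrunE
  rw [htoNat (r.2 - Y') (dL + 1) (by push_cast; omega)] at hrunB
  set i₀ := ω.2.firstHitG + MW + (dL + 1) + (dR + 1) + (dB + 1) with hi₀def
  obtain ⟨hfcq, hinq⟩ := hrunE (dB + 1) (by omega) (by omega)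
  have hfcq' : ω.2.fc i₀ = (k₀, w.2) := by rw [hfcq]; exact Prod.ext rfl (by push_cast; omega)
  set x₁ : ℤ := w.1 + k₁ with hx₁def
  have hk₁i : k₁ < i₀ := by omega
  ---------------------------------------------------------------- root-row plaquettes using `S` lie in the columns of the two legs
  have hrootS : ∀ x : ℤ, ω.2.UsesSide (x, w.2) .S → x = r.1 - MW ∨ x = k₀ := by
    intro x hu
    obtain ⟨M, hNall, -, hend⟩ := ω.2.chain_S hY' hu
    simp only at hNall hend
    rcases hend with ⟨hM1, hnot⟩ | ⟨-, hs0⟩ | ⟨hZ, -⟩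
    · obtain ⟨i', hi', hfc', hsv', -, -, -, hk'⟩ := ω.2.isolated_of_usesSide_not_opp (hNall M hM1 le_rfl) hnot
      have hP' : P (x, w.2 - M) := by rw [← hfc']; exact hPiso i' hi' hsv' hk'
      rcases hmem7 _ hP' with e | e | e | e | e | e | e
      · have := congrArg Prod.snd e; simp only at this; omega
      · have := congrArg Prod.snd e; rw [ht₂row] at this; simp only at this; omega
      · have := congrArg Prod.fst e; simp only at this; exact Or.inl this
      · have := congrArg Prod.fst e; simp only at this; exact Or.inr this
      · have := congrArg Prod.snd e; simp only at this; omega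
      · have := congrArg Prod.snd e; simp only at this; omega
      · have := congrArg Prod.snd e; simp only at this; omega
    · exact absurd hs0 h0S
    · rw [hL] at hZ; have := congrArg Prod.snd hZ; simp only at this; omega
  -- the straight climb column: plaquettes `(c, w.2 + m)`, `1 ≤ m ≤ dM`, carry straight arcs
  have hmidStraight : ∀ (c : ℤ) (m : ℕ), 1 ≤ m → m ≤ dM → ∀ l < n, ω.2.fc l = (c, w.2 + m) → arcKind (ω.2.sIn l) (ω.2.sOut l) = .straight := by
    intro c m hm1 hmM l hl hfl
    exact hvert l hl (by rw [hfl]; simp only; omega) (by rw [hfl]; simp only; omega) (by rw [hfl]; simp only; omega) (by rw [hfl]; simp only; omega)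
  -- the climb from a root-row plaquette `(c, w.2)` left through `N` at an index `j`
  have hclimb : ∀ (c : ℤ) (j : ℕ), j < n → ω.2.fc j = (c, w.2) → ω.2.sOut j = .N → c ≠ r.1 →
      (∀ m : ℕ, 1 ≤ m → (m : ℤ) ≤ r.2 - w.2 → ω.2.fc (j + m) = (c, w.2 + m) ∧ ω.2.sIn (j + m) = .S) ∧ j + (dM + 1) < n := by
    intro c j hj hfcj houtj hc
    have hcells : ∀ m : ℕ, 1 ≤ m → m ≤ dM → ∀ l < n, ω.2.fc l = ((ω.2.fc j).1, (ω.2.fc j).2 + m) → arcKind (ω.2.sIn l) (ω.2.sOut l) = .straight := by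
      intro m hm1 hmM l hl hfl
      rw [hfcj] at hfl; exact hmidStraight c m hm1 hmM l hl hfl
    have hjM : j + dM + 1 < n := by
      by_contra hge
      obtain ⟨e, -⟩ := ω.2.run_up_of_straight (j := j) (M := n - 1 - j) (by omega) houtj (fun m hm1 hmM l hl hfl => hcells m hm1 (by omega) l hl hfl)
        (n - 1 - j) le_rfl
      rw [show j + (n - 1 - j) = n - 1 by omega, hL, hfcj] at e
      have := congrArg Prod.fst e; simp only at this; omega
    have hrunU := ω.2.run_up_of_straight (j := j) (M := dM) (by omega) houtj hcells
    refine ⟨fun m hm1 hmM => ?_, by omega⟩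
    rcases Nat.lt_or_ge dM m with hlt | hle
    · -- the last step, into the row of `r`
      have em : m = dM + 1 := by omega
      subst em
      obtain ⟨hfcD, houtD⟩ := hrunU dM le_rfl
      rw [hfcj] at hfcD
      have e1 := ω.2.fc_succ_eq_of_sOut_N hjM houtD
      have e2 := sIn_succ_eq_S ω.2 hjM houtD
      rw [hfcD] at e1; simp only at e1
      rw [show j + (dM + 1) = j + dM + 1 by omega]
      exact ⟨by rw [e1]; exact Prod.ext rfl (by push_cast; ring), e2⟩
    · rcases Nat.eq_zero_or_pos m with h0 | hpos
      · omega
      obtain ⟨hfcD, houtD⟩ := hrunU (m - 1) (by omega)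
      rw [hfcj] at hfcD
      have hjm : j + (m - 1) + 1 < n := by omega
      have e1 := ω.2.fc_succ_eq_of_sOut_N hjm houtD
      have e2 := sIn_succ_eq_S ω.2 hjm houtD
      rw [hfcD] at e1; simp only at e1
      rw [show j + (m - 1) + 1 = j + m by omega] at e1 e2
      exact ⟨by rw [e1]; exact Prod.ext rfl (by push_cast [Nat.cast_sub hpos]; ring), e2⟩
  ---------------------------------------------------------------- the two cases of the root-row passage
  rcases eq_or_lt_of_le hk₀w with heq | hlt
  · ---------------------------------------------------------------- (I) the kiss at `p₁`
    have hqp : ω.2.fc i₀ = ω.2.fc k₁ := by rw [hfcq', hfk, heq]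
    obtain ⟨hno, h1, h2, h3, h4⟩ := YBWalk.not_straight_of_two_arcs (γ := ω.2) (i := k₁) (i' := i₀) (by omega) hi₀n (by omega) hqp
    rw [hWk] at h1 h3 hno
    rw [hinq] at h1 h2
    have hk₁N : ω.2.sOut k₁ = .N := by
      have hkns := hk₁ns
      rw [hWk] at hkns
      have hne := ω.2.sIn_ne_sOut (show k₁ < n by omega)
      rw [hWk] at hne
      revert h2 hkns hne hno; cases ω.2.sOut k₁ <;> decide
    rw [hk₁N] at h4
    have hqE : ω.2.sOut i₀ = .E := by
      have hne := ω.2.sIn_ne_sOut hi₀n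
      rw [hinq] at hne
      revert h3 h4 hne; cases ω.2.sOut i₀ <;> decide
    -- the `E`-chain of `p₁` ends at the root-row turn `τ`
    have hp₁E : ω.2.UsesSide (x₁, w.2) .E := ⟨i₀, hi₀n, by rw [hfcq', heq], Or.inr hqE⟩
    obtain ⟨Mτ, hτW, hτE, hendτ⟩ := ω.2.chain_E hX' hp₁E
    simp only at hτW hτE hendτ
    obtain ⟨hMτ, hτnE⟩ : (Mτ : ℤ) = τ1 - x₁ ∧ 1 ≤ Mτ ∧ ¬ω.2.UsesSide ((τ1 : ℤ), w.2) .E := by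
      rcases hendτ with ⟨hM1, hnot⟩ | ⟨-, hs0⟩ | ⟨-, hsZ⟩
      · obtain ⟨i', hi', hfc', hsv', -, -, -, hk'⟩ := ω.2.isolated_of_usesSide_not_opp (hτW Mτ hM1 le_rfl) hnot
        have hP' : P (x₁ + Mτ, w.2) := by rw [← hfc']; exact hPiso i' hi' hsv' hk'
        rcases hmem7 _ hP' with e | e | e | e | e | e | e
        · exfalso; have := congrArg Prod.snd e; simp only at this; omega
        · exfalso; have := congrArg Prod.snd e; rw [ht₂row] at this; simp only at this; omega
        · exfalso; have := congrArg Prod.snd e; simp only at this; omega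
        · exfalso; have := congrArg Prod.snd e; simp only at this; omega
        · have ex := congrArg Prod.fst e; simp only at ex
          refine ⟨by omega, hM1, ?_⟩
          rw [show ((τ1 : ℤ), w.2) = ((x₁ + (Mτ : ℤ), w.2) : Face) from Prod.ext (by simp only; omega) rfl]; exact hnot
        · exfalso; have := congrArg Prod.snd e; simp only at this; omega
        · exfalso; have := congrArg Prod.snd e; simp only at this; omega
      · exact absurd hs0 h0E
      · rw [hLS] at hsZ; exact absurd hsZ (by decide)
    obtain ⟨hMτ1, hτnE⟩ := hτnE
    obtain ⟨dE, hdE⟩ : ∃ dE : ℕ, (dE : ℤ) = τ1 - x₁ - 1 := ⟨(τ1 - x₁ - 1).toNat, by omega⟩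
    have hrowWStraight : ∀ m : ℕ, 1 ≤ m → m ≤ dE → ∀ l < n, ω.2.fc l = ((ω.2.fc i₀).1 + m, (ω.2.fc i₀).2) →
        arcKind (ω.2.sIn l) (ω.2.sOut l) = .straight := by
      intro m hm1 hmM l hl hfl
      rw [hfcq', ← heq] at hfl; simp only at hfl
      have hcS : ¬ω.2.UsesSide (x₁ + m, w.2) .S := by
        intro hu; rcases hrootS _ hu with e | e <;> omega
      exact ω.2.straight_of_usesSide_EW (hτE m (by omega)) (hτW m hm1 (by omega)) hcS l hl hfl
    have hiτ : i₀ + dE + 1 < n := by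
      by_contra hge
      obtain ⟨e, -⟩ := ω.2.run_east_of_straight (j := i₀) (M := n - 1 - i₀) (by omega) hqE (fun m hm1 hmM l hl hfl => hrowWStraight m hm1 (by omega) l hl hfl)
        (n - 1 - i₀) le_rfl
      rw [show i₀ + (n - 1 - i₀) = n - 1 by omega, hL, hfcq'] at e
      have := congrArg Prod.snd e; simp only at this; omega
    have hrunτ := ω.2.run_east_of_straight (j := i₀) (M := dE) (by omega) hqE hrowWStraight
    obtain ⟨hfcτ1, houtτ1⟩ := hrunτ dE le_rfl
    rw [hfcq'] at hfcτ1
    obtain ⟨hfcτ, hinτ⟩ := ω.2.fc_succ_eq_of_sOut_E hiτ houtτ1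
    rw [hfcτ1] at hfcτ; simp only at hfcτ
    have hfcτ' : ω.2.fc (i₀ + dE + 1) = ((τ1 : ℤ), w.2) := by rw [hfcτ]; exact Prod.ext (by simp only; omega) rfl
    -- `τ` is left through `N`
    have houtτ : ω.2.sOut (i₀ + dE + 1) = .N := by
      have hne := ω.2.sIn_ne_sOut hiτ
      rw [hinτ] at hne
      have hnE : ω.2.sOut (i₀ + dE + 1) ≠ .E := fun e => hτnE ⟨_, hiτ, hfcτ', Or.inr e⟩
      have hnS : ω.2.sOut (i₀ + dE + 1) ≠ .S := by
        intro e; rcases hrootS _ ⟨_, hiτ, hfcτ', Or.inr e⟩ with e' | e' <;> omega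
      revert hne hnE hnS; cases ω.2.sOut (i₀ + dE + 1) <;> decide
    obtain ⟨hclimbτ, hnτ⟩ := hclimb τ1 (i₀ + dE + 1) hiτ hfcτ' houtτ (by omega)
    have hdL' : (r.2 - Y').toNat = dL + 1 := htoNat _ _ (by push_cast; omega)
    have hdR' : (k₀ - (r.1 - MW)).toNat = dR + 1 := htoNat _ _ (by push_cast; omega)
    have hdB' : (w.2 - Y').toNat = dB + 1 := htoNat _ _ (by push_cast; omega)
    have hdM' : (r.2 - w.2).toNat = dM + 1 := htoNat _ _ (by push_cast; omega)
    have hdE' : (τ1 - (w.1 + (k₁ : ℤ))).toNat = dE + 1 := htoNat _ _ (by push_cast; omega)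
    have hcE' : ((τ1 : ℤ) - k₀).toNat = dE + 1 := htoNat _ _ (by push_cast; omega)
    refine ⟨τ1, Y, Y', τ1, k₀, MW, ME, k₁, t₂, hY, hY', hr₃, hY'w, ht₂row, ht₂col, hτ1w, hMW1, hME1, hEW, hWW, hnotW, hWE, hEE, hnotE, hseven, hall,
      hN1, hL, hLS, hdesc, hdescIn, heWS, heWnN, hlegN, hlegS, hbWnS, hk₁F, hstr, hk₁ns, hfk, hWk, hk₀w, hbotS, hbWnW, hbEnE, hbEnS, hinF, houtF,
      hrunR, ?_, ?_, ?_, ?_, Or.inl ⟨heq.symm, by omega, rfl, hk₁N, ?_, ?_, ?_⟩, ?_, ?_⟩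
    · exact hrunL
    · rw [hdL']; exact hrunB
    · rw [hdL', hdR']; exact hrunE
    · rw [hdL', hdR', hdB']; exact hi₀n
    · rw [hdL', hdR', hdB']; exact hqE
    · intro m hm1 hmM
      rw [hdL', hdR', hdB']
      clear hdL' hdR' hdB' hdM' hdE' hcE'
      rcases Nat.lt_or_ge dE m with hbig | hsmall
      · have em : m = dE + 1 := by omega
        subst em
        rw [show ω.2.firstHitG + MW + (dL + 1) + (dR + 1) + (dB + 1) + (dE + 1) = i₀ + dE + 1 by omega]
        exact ⟨by rw [hfcτ']; exact Prod.ext (by simp only; push_cast; omega) rfl, hinτ⟩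
      · rcases Nat.eq_zero_or_pos m with h0 | hpos
        · omega
        obtain ⟨e1, e1o⟩ := hrunτ (m - 1) (by omega)
        have hjm : i₀ + (m - 1) + 1 < n := by omega
        obtain ⟨e2, e3⟩ := ω.2.fc_succ_eq_of_sOut_E hjm e1o
        rw [e1, hfcq'] at e2; simp only at e2
        rw [show i₀ + (m - 1) + 1 = ω.2.firstHitG + MW + (dL + 1) + (dR + 1) + (dB + 1) + m by omega] at e2 e3
        exact ⟨by rw [e2]; exact Prod.ext (by simp only; push_cast [Nat.cast_sub hpos]; omega) rfl, e3⟩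
    · rw [hdL', hdR', hdB', hdE', show ω.2.firstHitG + MW + (dL + 1) + (dR + 1) + (dB + 1) + (dE + 1) = i₀ + dE + 1 from rfl]; exact houtτ
    · intro m hm1 hmM
      rw [hdL', hdR', hdB', hcE', show ω.2.firstHitG + MW + (dL + 1) + (dR + 1) + (dB + 1) + (dE + 1) + m = i₀ + dE + 1 + m from rfl]
      exact hclimbτ m hm1 hmM
    · rw [hdL', hdR', hdB', hcE', hdM', show ω.2.firstHitG + MW + (dL + 1) + (dR + 1) + (dB + 1) + (dE + 1) + (dM + 1) = i₀ + dE + 1 + (dM + 1) from rfl]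
      exact hnτ
  · ---------------------------------------------------------------- (II) straight across the root row, east of `p₁`
    -- `p₁` is singly visited: it is the root-row turn `τ`
    have hp₁nS : ¬ω.2.UsesSide (x₁, w.2) .S := by
      intro hu; rcases hrootS _ hu with e | e <;> omega
    have hsvp : ∀ l < n, ω.2.fc l = ω.2.fc k₁ → l = k₁ := fun l hl e =>
      ω.2.single_visit_of_not_usesSide hp₁nS hl (by omega) (e.trans hfk) hfk
    have hPp : P (x₁, w.2) := by rw [← hfk]; exact hPiso k₁ (by omega) hsvp hk₁ns
    have hτx : τ1 = x₁ := by
      rcases hmem7 _ hPp with e | e | e | e | e | e | e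
      · have := congrArg Prod.snd e; simp only at this; omega
      · have := congrArg Prod.snd e; rw [ht₂row] at this; simp only at this; omega
      · have := congrArg Prod.snd e; simp only at this; omega
      · have := congrArg Prod.snd e; simp only at this; omega
      · have := congrArg Prod.fst e; simp only at this; omega
      · have := congrArg Prod.snd e; simp only at this; omega
      · have := congrArg Prod.snd e; simp only at this; omega
    have hp₁nE : ¬ω.2.UsesSide (x₁, w.2) .E := by
      rintro ⟨l, hl, hfl, hs⟩
      have el := hsvp l hl (hfl.trans hfk.symm)
      subst el
      rw [hWk] at hs
      rcases hs with hs | hs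
      · exact absurd hs (by decide)
      · apply hk₁ns; rw [hWk, hs]; decide
    -- `q` does not use `W`: its `W`-chain would end at `p₁` or run through it
    have hqnW : ¬ω.2.UsesSide (k₀, w.2) .W := by
      intro hu
      obtain ⟨M, hEall, hWall, hend⟩ := ω.2.chain_W hX hu
      simp only at hEall hWall hend
      rcases hend with ⟨hM1, hnot⟩ | ⟨hA0, -⟩ | ⟨-, hsZ⟩
      · obtain ⟨i', hi', hfc', hsv', -, -, -, hk'⟩ := ω.2.isolated_of_usesSide_not_opp (hEall M hM1 le_rfl) hnot
        have hP' : P (k₀ - M, w.2) := by rw [← hfc']; exact hPiso i' hi' hsv' hk'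
        rcases hmem7 _ hP' with e | e | e | e | e | e | e
        · have := congrArg Prod.snd e; simp only at this; omega
        · have := congrArg Prod.snd e; rw [ht₂row] at this; simp only at this; omega
        · have := congrArg Prod.snd e; simp only at this; omega
        · have := congrArg Prod.snd e; simp only at this; omega
        · have ex := congrArg Prod.fst e; simp only at ex
          -- the end is `τ = p₁`, which uses `W`
          apply hnot
          rw [show ((k₀ - (M : ℤ), w.2) : Face) = (x₁, w.2) from Prod.ext (by simp only; omega) rfl]
          exact ⟨k₁, by omega, hfk, Or.inl hWk⟩
        · have := congrArg Prod.snd e; simp only at this; omega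
        · have := congrArg Prod.snd e; simp only at this; omega
      · -- the end is `fc 0 = w`: then `p₁` uses `E`
        rw [h0w] at hA0
        have ex := congrArg Prod.fst hA0; simp only at ex
        obtain ⟨m, hm⟩ : ∃ m : ℕ, (m : ℤ) = k₀ - x₁ := ⟨(k₀ - x₁).toNat, by omega⟩
        have := hEall m (by omega) (by omega)
        rw [show ((k₀ - (m : ℤ), w.2) : Face) = (x₁, w.2) from Prod.ext (by simp only; omega) rfl] at this
        exact hp₁nE this
      · rw [hLS] at hsZ; exact absurd hsZ (by decide)
    have hsvq : ∀ l < n, ω.2.fc l = ω.2.fc i₀ → l = i₀ := fun l hl e =>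
      ω.2.single_visit_of_not_usesSide hqnW hl hi₀n (e.trans hfcq') hfcq'
    -- `q` is left through `N`
    have hqN : ω.2.sOut i₀ = .N := by
      have hne := ω.2.sIn_ne_sOut hi₀n
      rw [hinq] at hne
      have hnW : ω.2.sOut i₀ ≠ .W := fun e => hqnW ⟨_, hi₀n, hfcq', Or.inr e⟩
      have hnE : ω.2.sOut i₀ ≠ .E := by
        intro hE
        -- a corner `S → E`: `q` would be an isolated root-row turn other than `τ = p₁`
        have hPq : P (k₀, w.2) := by rw [← hfcq']; exact hPiso i₀ hi₀n hsvq (by rw [hinq, hE]; decide)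
        rcases hmem7 _ hPq with e | e | e | e | e | e | e
        · have := congrArg Prod.snd e; simp only at this; omega
        · have := congrArg Prod.snd e; rw [ht₂row] at this; simp only at this; omega
        · have := congrArg Prod.snd e; simp only at this; omega
        · have := congrArg Prod.snd e; simp only at this; omega
        · have := congrArg Prod.fst e; simp only at this; omega
        · have := congrArg Prod.snd e; simp only at this; omega
        · have := congrArg Prod.snd e; simp only at this; omega
      revert hne hnW hnE; cases ω.2.sOut i₀ <;> decide
    obtain ⟨hclimbq, hnq⟩ := hclimb k₀ i₀ hi₀n hfcq' hqN (by omega)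
    have hdL' : (r.2 - Y').toNat = dL + 1 := htoNat _ _ (by push_cast; omega)
    have hdR' : (k₀ - (r.1 - MW)).toNat = dR + 1 := htoNat _ _ (by push_cast; omega)
    have hdB' : (w.2 - Y').toNat = dB + 1 := htoNat _ _ (by push_cast; omega)
    have hdM' : (r.2 - w.2).toNat = dM + 1 := htoNat _ _ (by push_cast; omega)
    have hc0 : (k₀ - k₀).toNat = 0 := by simp
    refine ⟨k₀, Y, Y', τ1, k₀, MW, ME, k₁, t₂, hY, hY', hr₃, hY'w, ht₂row, ht₂col, hτ1w, hMW1, hME1, hEW, hWW, hnotW, hWE, hEE, hnotE, hseven, hall,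
      hN1, hL, hLS, hdesc, hdescIn, heWS, heWnN, hlegN, hlegS, hbWnS, hk₁F, hstr, hk₁ns, hfk, hWk, hk₀w, hbotS, hbWnW, hbEnE, hbEnS, hinF, houtF,
      hrunR, ?_, ?_, ?_, ?_, Or.inr ⟨hlt, hτx, rfl, hp₁nS, hp₁nE, hqnW, ?_⟩, ?_, ?_⟩
    · exact hrunL
    · rw [hdL']; exact hrunB
    · rw [hdL', hdR']; exact hrunE
    · rw [hdL', hdR', hdB']; exact hi₀n
    · rw [hdL', hdR', hdB']; exact hqN
    · intro m hm1 hmM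
      rw [hdL', hdR', hdB', hc0, add_zero]
      exact hclimbq m hm1 hmM
    · rw [hdL', hdR', hdB', hc0, add_zero, hdM']; exact hnq

end ΩG

end Literature.Probability.RandomPlanarGeometry.SAW.YangBaxter
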